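import Summits.CriticalPhenomena.Ising3DConformalLimit.Theses.SynchronousCoupling
import Summits.CriticalPhenomena.Ising3DConformalLimit.Theorems.UniformRegularity.Negative.LoadBearing
import Summits.CriticalPhenomena.Ising3DConformalLimit.Theorems.UniformRegularity.Negative.QuantifierLoadBearing
import Summits.CriticalPhenomena.Ising3DConformalLimit.Theorems.UniformRegularity.Negative.UniformConstants
import Summits.CriticalPhenomena.Ising3DConformalLimit.Theorems.HyperoctahedralRPExistsScaleCovariantLimitCompactnessItemMapsDoubling
import Summits.CriticalPhenomena.Ising3DConformalLimit.Theorems.HyperoctahedralRPExistsScaleCovariantLimitFunnelThroughDoubling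
import Summits.CriticalPhenomena.Ising3DConformalLimit.Theorems.HyperoctahedralRPExistsScaleCovariantLimitFoldedCurrentHeavyScaleDoubling
import Summits.CriticalPhenomena.Ising3DConformalLimit.Theorems.ExistsScaleCovariantLimit.Negative.PureExistence
import Summits.CriticalPhenomena.Ising3DConformalLimit.Theorems.ZoomMonotone.Negative.AxisStructureInsufficient
import Literature.Barriers.CriticalPhenomena.AxisProfileAxiomaticsNoDoubling
import HarnessLib

/-!
# Disproof of `UniformRegularity` (item stmt-CriticalPhenomena-4658) — findings, cycle 1 (2026-08-17)

Standing crux disprover (`cdisprove`), route `SynchronousCoupling` r4 (decl shared VERBATIM with routes `ClusterRigidity`,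
`MonotoneRG`, `MirrorHoelderCompactness`; `Iff.rfl`, §0). The crux: on every compact `K ⊆ NonCoincident 3 n` the pinned rescaled
critical correlators `F_δ(n;x) = ρ★(δ)ⁿ⟨∏σ_{[xᵢ/δ]}⟩⁺_{β_c}`, `ρ★(δ) = ⟨σ₀σ_{⌊δ⁻¹⌋e₀}⟩^{-1/2}`, are (a) bounded, (b) asymptotically
uniformly equicontinuous, (c) bounded below at `n = 2`, for `δ < δ₀(K)` (resp. `δ₀(ε, K)` in (b)).

VERDICT (cycle 1): NOT REFUTED — and not refutable short of refuting the sub-problem itself. §0 proves (from landed theorems)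
`crux ⟺ TwoPointDoubling` (item 6150: `∃ κ>0, ∀ n≥1, κ g(n) ≤ g(2n)`, `g(k) = ⟨σ₀σ_{ke₀}⟩⁺_{β_c(ℤ³)}`) and
`¬crux ⟹ ¬Ising3DConformalLimit`. All-scale doubling of the critical two-point function on `ℤ³` is explicitly open
(ADC21 Remark 5.10, §5.6; DC ICM22 §8.4) and universally expected (`g(2n)/g(n) → 2^{-(1+η)} ≈ 0.4876`, bootstrap
`η = 0.036298(2)`, MC `η = 0.03627(10)`); no counterexample family, degenerate regime or barrier reduction bites (§D).

## Index of findings (all sorry-free; landed copies named for import)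

* §0 POSITION — `crux_iff_monotoneRG` (`Iff.rfl`), `crux_iff_clauses` (readable clause form, `Iff.rfl`),
  `crux_iff_twoPointDoubling` (landed item map p120504), `not_conjunct_of_not_crux` (¬crux ⟹ ¬Ising3DConformalLimit:
  the crux is NECESSARY for the sub-problem), `not_crux_iff` (refutation criterion: `∀ κ>0 ∃ n≥1, g(2n) < κ g(n)`),
  `not_crux_light_scales` (RP localisation, landed `FoldedCurrentRepulsion.not_doubling_level_lt`: a non-doubling scale
  `n ≥ 2` is LIGHT, `n g(n) < 2Cκ^{1/4}` — a disproof must exhibit exponential episodes at arbitrarily light scales).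
* §A LOAD-BEARING HYPOTHESES (theorems `uniformRegularity_false_without_<H>`; landed witnesses in
  `Theorems/UniformRegularity/Negative/LoadBearing.lean` (p143266, rattack refuter) and `…/QuantifierLoadBearing.lean`
  (p158659, this seat)):
  - `K ⊆ NonCoincident` — dropped ⟹ false: clause (a) at `K = {(0,0)}` (`F = 1/g(⌊δ⁻¹⌋e₀) → ∞`), clause (b) on the segment
    `{(0,te₀): t∈[0,1]}` (gap `≥ 1/2` across the diagonal);
  - `IsCompact K` — dropped ⟹ false: (a) and (b) on `{(0,te₀): t∈(0,1]}`, (c) on `{(0,te₀): t ≥ 1}`;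
  - the quantifier order `∀ ε ∃ δ₀` in (b) — `δ₀` chosen BEFORE `ε` ⟹ false (fixed-mesh step functions jump:
    `uniformRegularity_false_with_meshUniform_delta0`);
  - the order `n = 2` in (c) — (c) at any odd order ⟹ false (`F ≡ 0`, `m*(β_c)=0`): `uniformRegularity_false_with_lowerBound_allOrders`.
  So every hypothesis of the crux is load-bearing; nothing is decoration.
* §B TIGHTNESS — `pinned_normalisation'` (`F_δ(2;0,e₀) = 1` ∀δ: no free constant), `clauseC_const_le_one` (any admissible
  `m` in (c) on a `K ∋ (0,e₀)` has `m ≤ 1`), `hyps_satisfiable'`.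
* §C REFUTED STRENGTHENINGS (model-blind) — the catalogued barrier `Literature.Barriers.CriticalPhenomena.AxisProfileAxiomaticsNoDoubling`
  ALREADY proves the strong form: a lacunary mixture of massive episodes has every axis-profile fact (MMS, RP / full Källén–Lehmann
  representation, both envelopes, sliding-scale IR bound, DCP Thm 1.3 in profile form, even `g ≥ n^{-3/2}/96` at every scale) and is
  NOT doubling (`exists_axisProfileFacts_not_axisDoubling`, `not_forall_axisProfileDoublingFor`); here `crux_iff_barrierAxisDoubling`
  reads the crux as EXACTLY the barrier's `AxisDoubling` of the real profile, so the barrier blocks profile-axiomatic PROOFS and,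
  symmetrically, profile-axiomatic DISPROOFS (the real profile may double while satisfying every listed fact). Companion in the
  sibling refuter's `AxisFacts` currency (adds `g ≤ 1`, ratios `→ 1`, three-term log-convexity): tangent-envelope witness `gT`,
  `Negative/AxisFactsNotDoubling.lean` (p161904, review-queued at publication) — statement recorded here as `AxisFactsDecideDoubling`.
* §D ATTACKS THAT DO NOT BITE (recorded so nobody repeats them) — see the docstring of `attacks_record`.
* §E TARGETS (line `Sketch` = magnetic ruler, `Lines/Sketch.lean`, 5 stubs; payload targets empty this cycle) — paper check:
  stubs 1–4 TRUE as typed (GKS-in-h; GHS truncated monotonicity anchored at `m*(β_c)=0`; Lee–Yang continuity + `M(h)>0`;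
  GHS concavity sum rule — the factor `β_c` matches the tree's weight `exp(β(Σσσ + hΣσ))`, `isingWeight`/`isingHamiltonian`);
  stub 5 (ECP) ⟺ 6150 by the lead's own `excessPropagation_of_doubling`/`twoPointDoubling_of`. No target broken.
* §F UNIFORMITY IN `K` IS LOAD-BEARING (was the cycle's near-miss; now landed, `Negative/UniformConstants.lean`, p162198) —
  `uniformRegularity_false_with_bound_uniform_in_K` / `…_lowerBound_uniform_in_K`: one `M` (clause (a)) or one `m > 0` (clause (c))
  for ALL compact `K ⊆ NonCoincident 3 2` is false. The obstruction noted in v1/v2 (the window cannot certify a large value of `F`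
  at an adversarial `δ₀`) is bypassed by the free choice of the mesh along a geometric sequence `δ = 1/(N₀mʲ)`: a uniform bound
  would force `g(N₀ mʲ e₀) ≥ M^{-j} g(N₀ e₀)`, against the infrared bound once `m > M`. No near-miss remains sorried.

References: Aizenman–Duminil-Copin, Ann. Math. 194 (2021) = arXiv:1912.07973 (Prop. 5.3, Rem. 5.10, §5.6);
Duminil-Copin, ICM 2022 §8.4; Duminil-Copin–Panis arXiv:2404.05700; Kos–Poland–Simmons-Duffin–Vichi JHEP 2016 (η);
Hasenbusch PRB 82 (2010) 174433 (MC η); Simon CMP 77 (1980); Fröhlich–Simon–Spencer CMP 50 (1976); Messager–Miracle-Solé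
JSP 17 (1977); Aizenman–Duminil-Copin–Sidoravicius CMP 334 (2015).
-/

noncomputable section

open Filter Set
open scoped Topology
open Literature.Probability.LatticeModels
open Summit.CriticalPhenomena.Ising3DConformalLimit.Theses
open Summit.CriticalPhenomena.Ising3DConformalLimit.UniformRegularityNegative
open Summit.CriticalPhenomena.Ising3DConformalLimit.Theorems.ZoomMonotone.Negative (AxisFacts gAxis axisFacts_criticalTwoPoint)

namespace Summit.CriticalPhenomena.Ising3DConformalLimit.Cruxes.UniformRegularity.Disproof

/-! ## Vocabulary: the pinned renormalisation and the three clauses -/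

/-- `ρ★(δ) = ⟨σ₀σ_{⌊δ⁻¹⌋e₀}⟩^{-1/2}` exactly as in the item. [folklore] -/
abbrev rhoStar : ℝ → ℝ := fun δ : ℝ => (criticalTwoPoint 3 (Pi.single 0 ⌊δ⁻¹⌋)) ^ (-(1/2:ℝ))

/-- `F_δ(n; x)`, the pinned rescaled critical `n`-point correlator. [folklore] -/
abbrev F (n : ℕ) (δ : ℝ) (x : Fin n → EuclideanSpace ℝ (Fin 3)) : ℝ :=
  rescaledCorrelator (criticalCorr 3) rhoStar n δ x

/-- Clause (a) on `K` at order `n`: local boundedness uniformly in small meshes. [folklore] -/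
def ClauseA (n : ℕ) (K : Set (Fin n → EuclideanSpace ℝ (Fin 3))) : Prop :=
  ∃ M δ₀ : ℝ, 0 < δ₀ ∧ ∀ δ ∈ Set.Ioo 0 δ₀, ∀ x ∈ K, |F n δ x| ≤ M

/-- Clause (b) on `K` at order `n`: asymptotic uniform equicontinuity (`δ₀ = δ₀(ε)`). [folklore] -/
def ClauseB (n : ℕ) (K : Set (Fin n → EuclideanSpace ℝ (Fin 3))) : Prop :=
  ∀ ε : ℝ, 0 < ε → ∃ r δ₀ : ℝ, 0 < r ∧ 0 < δ₀ ∧ ∀ δ ∈ Set.Ioo 0 δ₀, ∀ x ∈ K, ∀ y ∈ K,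
    dist x y < r → |F n δ x - F n δ y| < ε

/-- Clause (c) on `K` at order `n` (the item uses `n = 2`): a positive lower bound. [folklore] -/
def ClauseC (n : ℕ) (K : Set (Fin n → EuclideanSpace ℝ (Fin 3))) : Prop :=
  ∃ m δ₀ : ℝ, 0 < m ∧ 0 < δ₀ ∧ ∀ δ ∈ Set.Ioo 0 δ₀, ∀ x ∈ K, m ≤ F n δ x

/-! ## §0 Position of the crux -/

/-- The four route copies are one decl (shared item 4658). [folklore] -/
theorem crux_iff_monotoneRG : SynchronousCoupling.UniformRegularity ↔ MonotoneRG.UniformRegularity := Iff.rfl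

/-- The crux in clause form. [folklore] -/
theorem crux_iff_clauses :
    SynchronousCoupling.UniformRegularity ↔
      (∀ (n : ℕ) (K : Set (Fin n → EuclideanSpace ℝ (Fin 3))), K ⊆ NonCoincident 3 n → IsCompact K →
          ClauseA n K ∧ ClauseB n K) ∧
        ∀ K : Set (Fin 2 → EuclideanSpace ℝ (Fin 3)), K ⊆ NonCoincident 3 2 → IsCompact K → ClauseC 2 K :=
  Iff.rfl

/-- **crux ⟺ item 6150 `TwoPointDoubling`** (landed `ItemMaps.uniformRegularity_iff_doubling`, p120504).
[cite: AizenmanDuminilCopinAnnals2021, arXiv:1912.07973 Remark 5.10] -/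
theorem crux_iff_twoPointDoubling :
    SynchronousCoupling.UniformRegularity ↔ MirrorHoelderCompactness.TwoPointDoubling :=
  ExistsScaleCovariantLimit.TwoHierarchies.ItemMaps.uniformRegularity_iff_doubling

/-- **The crux is NECESSARY for the sub-problem**: `¬crux ⟹ ¬Ising3DConformalLimit` (conjunct ⟹ `ExistsScaleCovariantLimit`
⟹ 6150 ⟹ 4658, all landed). An unconditional refutation of this crux would refute the summit conjunct as typed. [folklore] -/
theorem not_conjunct_of_not_crux (h : ¬ SynchronousCoupling.UniformRegularity) : ¬ _root_.Ising3DConformalLimit :=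
  ExistsScaleCovariantLimitNegative.not_conjunct_of_not_crux fun hcrux =>
    h (crux_iff_twoPointDoubling.2 (ExistsScaleCovariantLimit.Funnel.twoPointDoubling_of_crux hcrux))

/-- **Refutation criterion** (`ρ★`-free, on the lattice): the crux fails iff the axis doubling ratio has `liminf = 0`,
i.e. `∀ κ > 0 ∃ n ≥ 1, g(2n e₀) < κ g(n e₀)`. [folklore] -/
theorem not_crux_iff :
    ¬ SynchronousCoupling.UniformRegularity ↔
      ∀ κ : ℝ, 0 < κ → ∃ n : ℕ, 1 ≤ n ∧
        criticalTwoPoint 3 (Pi.single 0 (2 * (n : ℤ))) < κ * criticalTwoPoint 3 (Pi.single 0 (n : ℤ)) := by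
  rw [crux_iff_twoPointDoubling]
  unfold MirrorHoelderCompactness.TwoPointDoubling
  push Not
  rfl

/-- **Where a refutation must live** (RP localisation, landed `not_doubling_level_lt`): if the crux fails then for every
`κ ∈ (0,1]` there is a non-doubling scale `n ≥ 1`, and every such scale `n ≥ 2` is LIGHT: `n·g(n e₀) < 2C κ^{1/4}`.
(In the expected world `n g(n) → 0` anyway, `η > 0`: the criterion localises, it does not decide.)
[cite: AizenmanDuminilCopinAnnals2021, arXiv:1912.07973 Remark 5.10 (p. 20)] -/
theorem not_crux_light_scales (h : ¬ SynchronousCoupling.UniformRegularity) :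
    ∃ C : ℝ, 0 < C ∧ ∀ κ : ℝ, 0 < κ → κ ≤ 1 → ∃ n : ℕ, 1 ≤ n ∧
      criticalTwoPoint 3 (Pi.single 0 (2 * (n : ℤ))) < κ * criticalTwoPoint 3 (Pi.single 0 (n : ℤ)) ∧
      (2 ≤ n → (n : ℝ) * criticalTwoPoint 3 (Pi.single 0 (n : ℤ)) < 2 * C * κ ^ ((1 : ℝ) / 4)) := by
  obtain ⟨C, hC, hloc⟩ := ExistsScaleCovariantLimit.FoldedCurrentRepulsion.not_doubling_level_lt
  refine ⟨C, hC, fun κ hκ hκ1 => ?_⟩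
  obtain ⟨n, hn, hfail⟩ := not_crux_iff.1 h κ hκ
  exact ⟨n, hn, hfail, fun h2 => hloc κ hκ hκ1 n h2 hfail⟩

/-! ## §A Load-bearing hypotheses (`any proof must use H`) -/

/-- The crux with `K ⊆ NonCoincident` DROPPED everywhere. [folklore] -/
def UniformRegularityWithoutNonCoincident : Prop :=
  (∀ (n : ℕ) (K : Set (Fin n → EuclideanSpace ℝ (Fin 3))), IsCompact K → ClauseA n K ∧ ClauseB n K) ∧
    ∀ K : Set (Fin 2 → EuclideanSpace ℝ (Fin 3)), IsCompact K → ClauseC 2 K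

/-- **`K ⊆ NonCoincident` is load-bearing** — TWO independent witnesses: clause (a) at `K = {(0,0)}`
(`clauseA_false_without_nonCoincident`, p143266) and clause (b) on the segment through the diagonal
(`clauseB_false_without_nonCoincident`, p158659). (Clause (c) alone survives the drop near the diagonal, where `F → +∞`.) [folklore] -/
theorem uniformRegularity_false_without_NonCoincident : ¬ UniformRegularityWithoutNonCoincident := fun h =>
  clauseA_false_without_nonCoincident fun n K hK => (h.1 n K hK).1

/-- The same, through clause (b) only. [folklore] -/
theorem uniformRegularity_false_without_NonCoincident' : ¬ UniformRegularityWithoutNonCoincident := fun h =>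
  clauseB_false_without_nonCoincident fun n K hK => (h.1 n K hK).2

/-- The crux with `IsCompact K` DROPPED everywhere. [folklore] -/
def UniformRegularityWithoutCompact : Prop :=
  (∀ (n : ℕ) (K : Set (Fin n → EuclideanSpace ℝ (Fin 3))), K ⊆ NonCoincident 3 n → ClauseA n K ∧ ClauseB n K) ∧
    ∀ K : Set (Fin 2 → EuclideanSpace ℝ (Fin 3)), K ⊆ NonCoincident 3 2 → ClauseC 2 K

/-- **`IsCompact K` is load-bearing** — THREE independent witnesses, one per clause: (a) and (b) on `{(0,te₀): t ∈ (0,1]}`,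
(c) on `{(0,te₀): t ≥ 1}` (`clauseA/B/C_false_without_compact`, p143266 / p158659). [folklore] -/
theorem uniformRegularity_false_without_Compact : ¬ UniformRegularityWithoutCompact := fun h =>
  clauseC_false_without_compact h.2

/-- The same, through clause (a) only. [folklore] -/
theorem uniformRegularity_false_without_Compact' : ¬ UniformRegularityWithoutCompact := fun h =>
  clauseA_false_without_compact fun n K hK => (h.1 n K hK).1

/-- The same, through clause (b) only. [folklore] -/
theorem uniformRegularity_false_without_Compact'' : ¬ UniformRegularityWithoutCompact := fun h =>
  clauseB_false_without_compact fun n K hK => (h.1 n K hK).2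

/-- Clause (b) with the mesh threshold `δ₀` chosen BEFORE `ε` (equicontinuity of the whole family `{F_δ : δ < δ₀}`). [folklore] -/
def ClauseBMeshUniform (n : ℕ) (K : Set (Fin n → EuclideanSpace ℝ (Fin 3))) : Prop :=
  ∃ δ₀ : ℝ, 0 < δ₀ ∧ ∀ ε : ℝ, 0 < ε → ∃ r : ℝ, 0 < r ∧ ∀ δ ∈ Set.Ioo 0 δ₀, ∀ x ∈ K, ∀ y ∈ K,
    dist x y < r → |F n δ x - F n δ y| < ε

/-- The crux with clause (b) STRENGTHENED to mesh-uniform equicontinuity. [folklore] -/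
def UniformRegularityMeshUniform : Prop :=
  ∀ (n : ℕ) (K : Set (Fin n → EuclideanSpace ℝ (Fin 3))), K ⊆ NonCoincident 3 n → IsCompact K → ClauseBMeshUniform n K

/-- **The order `∀ ε ∃ δ₀` in clause (b) is load-bearing**: mesh-uniform equicontinuity fails on the compact
`{(0,te₀): t∈[1,3]} ⊆ NonCoincident 3 2` — at fixed mesh `F_δ(2;·)` is a step function with a genuine jump
`(g(ke₀) − g((k+1)e₀))/g(⌊δ⁻¹⌋e₀) > 0` inside `K` (`clauseB_false_with_meshUniform_delta0`, p158659). [folklore] -/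
theorem uniformRegularity_false_with_meshUniform_delta0 : ¬ UniformRegularityMeshUniform :=
  clauseB_false_with_meshUniform_delta0

/-- The crux with clause (c) demanded at EVERY order `n` (not only `n = 2`). [folklore] -/
def UniformRegularityLowerAllOrders : Prop :=
  ∀ (n : ℕ) (K : Set (Fin n → EuclideanSpace ℝ (Fin 3))), K ⊆ NonCoincident 3 n → IsCompact K → ClauseC n K

/-- **The restriction of clause (c) to `n = 2` is load-bearing**: at every odd order `F_δ(n;·) ≡ 0` (`m*(β_c) = 0`), so the
all-orders lower bound fails already at `n = 1` (`clauseC_false_at_odd`, p158659). (Even orders `n ≥ 4` WOULD follow from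
`n = 2` by Griffiths II — positive content, provers' side.) [folklore] -/
theorem uniformRegularity_false_with_lowerBound_allOrders : ¬ UniformRegularityLowerAllOrders := fun h =>
  clauseC_false_at_odd odd_one (h 1)

/-! ## §B Tightness: the pin leaves no free constant -/

/-- The hypotheses have a non-trivial model (compact set of non-coincident pairs). [folklore] -/
theorem hyps_satisfiable' : ∃ K : Set (Fin 2 → EuclideanSpace ℝ (Fin 3)),
    K ⊆ NonCoincident 3 2 ∧ IsCompact K ∧ K.Nonempty := hyps_satisfiable

/-- `F_δ(2; 0, e₀) = 1` for every mesh. [folklore] -/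
theorem pinned_normalisation' (δ : ℝ) : F 2 δ ![0, EuclideanSpace.single (0 : Fin 3) (1:ℝ)] = 1 :=
  pinned_normalisation δ

/-- **Clause (c) is tight at the pin**: an admissible lower constant `m` on any `K ∋ (0, e₀)` has `m ≤ 1` (and the bound
`1` is attained at every mesh). [folklore] -/
theorem clauseC_const_le_one {K : Set (Fin 2 → EuclideanSpace ℝ (Fin 3))}
    (hK : ((![0, EuclideanSpace.single (0 : Fin 3) (1:ℝ)] : Fin 2 → EuclideanSpace ℝ (Fin 3))) ∈ K)
    {m δ₀ : ℝ} (hδ₀ : 0 < δ₀) (h : ∀ δ ∈ Set.Ioo 0 δ₀, ∀ x ∈ K, m ≤ F 2 δ x) : m ≤ 1 := by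
  have := h (δ₀ / 2) ⟨by positivity, by linarith⟩ _ hK
  rwa [pinned_normalisation'] at this

/-! ## §C Refuted strengthenings (model-blind) -/

/-- "The tree's axis-facts package decides doubling": every `g : ℕ → ℝ` with `AxisFacts g` is doubling. By
`crux_iff_twoPointDoubling` + `axisFacts_criticalTwoPoint` this WOULD prove the crux. [folklore] -/
def AxisFactsDecideDoubling : Prop :=
  ∀ g : ℕ → ℝ, AxisFacts g → ∃ κ : ℝ, 0 < κ ∧ ∀ n : ℕ, 1 ≤ n → κ * g n ≤ g (2 * n)

/-- If the axis-facts package decided doubling, the crux would follow (so `¬ AxisFactsDecideDoubling`, proved in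
`Negative/AxisFactsNotDoubling.lean` by the tangent-envelope witness `gT` — proposal pending when this file was written —
says exactly that a proof of the crux needs input beyond the package). [folklore] -/
theorem crux_of_axisFactsDecideDoubling (h : AxisFactsDecideDoubling) : SynchronousCoupling.UniformRegularity := by
  rw [crux_iff_twoPointDoubling]
  obtain ⟨κ, hκ, hd⟩ := h gAxis axisFacts_criticalTwoPoint
  refine ⟨κ, hκ, fun n hn => ?_⟩
  have := hd n hn
  unfold gAxis at this
  have hcast : ((2 * n : ℕ) : ℤ) = 2 * (n : ℤ) := by push_cast; ring
  rwa [hcast] at this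

/-- **The crux is EXACTLY the barrier's `AxisDoubling` of the real axis profile** (so the catalogued barrier
`AxisProfileAxiomaticsNoDoubling` applies verbatim: no profile-axiomatic argument proves it — and none refutes it). [folklore] -/
theorem crux_iff_barrierAxisDoubling :
    SynchronousCoupling.UniformRegularity ↔
      Literature.Barriers.CriticalPhenomena.AxisDoubling (fun n : ℕ => criticalTwoPoint 3 (Pi.single 0 (n : ℤ))) := by
  rw [crux_iff_twoPointDoubling]
  unfold MirrorHoelderCompactness.TwoPointDoubling Literature.Barriers.CriticalPhenomena.AxisDoubling
  have hcast : ∀ n : ℕ, ((2 * n : ℕ) : ℤ) = 2 * (n : ℤ) := fun n => by push_cast; ring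
  simp_rw [hcast]

/-- The barrier's master statement, re-exported next to the crux: the technique class "doubling from the axis-profile facts
(+ Källén–Lehmann)" is EMPTY. [cite: AizenmanDuminilCopinAnnals2021, arXiv:1912.07973 Remark 5.10 and §5.6] -/
theorem profileAxiomatics_decide_nothing :
    ¬ ∀ g : ℕ → ℝ, Literature.Barriers.CriticalPhenomena.AxisProfileDoublingFor g :=
  Literature.Barriers.CriticalPhenomena.not_forall_axisProfileDoublingFor

/-! ## §D Attacks that do not bite (record) -/

/-- **Record of cycle-1 attacks** (statement `True`; the content is this docstring, kept next to the Lean so the provers see it).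
1. *Degenerate orders*: `n = 0` (`F ≡ 1`), odd `n` (`F ≡ 0`) are trivially TRUE instances of (a),(b); (c) is only asked at `n = 2`.
   `K = ∅` trivial. Singleton `K = {(0,e₀)}`: (a),(c) hold with `M = m = 1` (pin); (b) vacuous for `r` small. A two-point compact
   `K = {(0,e₀),(0,2e₀)}` already encodes dyadic doubling `g(2N)/g(N) ≥ m` — i.e. the open content appears at the first
   non-trivial compact; no degenerate instance is false.
2. *Junk values*: `ρ★` base `g(⌊δ⁻¹⌋e₀) > 0` (Simon–Lieb), `rpow` safe; `δ ∈ (δ₀ ∩ (1,∞))` gives `⌊δ⁻¹⌋ = 0`, `ρ★ = 1`, harmless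
   (`∃ δ₀`); floor discretisation makes `F_δ` a step function — absorbed by `δ₀(ε)` in (b) (and ONLY by it: §A).
3. *Small models / computation*: the object is the infinite-volume `β_c` state of `ℤ³` (`β_c` not computable in closed form);
   no finite certificate can refute an `∃κ ∀n` statement about it. Numerics all point the other way: `g(2n)/g(n)` decreases
   smoothly from `g(2)/g(1) ≈ 0.6` to `2^{-1.0363} ≈ 0.4876` (bootstrap `Δ_σ = 0.5181489(10)`; MC Hasenbusch 2010).
4. *Barrier reductions* (`Literature/Barriers/CriticalPhenomena/`): the one entry that concerns this crux is
   `AxisProfileAxiomaticsNoDoubling` (§C): it bounds TECHNIQUES (profile axiomatics decide nothing either way) and supplies no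
   counterexample for the n.n. model itself. `RigorousRGSmallParameter`, `PositionSpaceRGNonGibbsian`, `ScaleCovarianceNotMoebius`,
   `TwoPointLawNotMoebius`, `IsingTrivialityFromDimensionFour`, `LongRangeTrivialityOnZ3`, `BootstrapLatticeBlindness` — none produces
   a non-doubling profile for the n.n. model on `ℤ³`; triviality barriers concern `U₄`, not two-point regularity (doubling holds for
   the GFF, `g ∼ k⁻¹`, and in `d ≥ 5` where `g ≍ k^{2-d}` is proved).
5. *Negatives index* (`ledger negatives`, 2026-08-17): no refuted statement concerns `criticalTwoPoint 3` or doubling.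
6. *Model-blind insufficiency*: the axis-profile facts do NOT decide the crux (§C, catalogued barrier + `gT`) — so
   "RP + IR + MMS + sliding-scale + DCP-profile" attacks cannot refute it either: the real `g` could a priori sit anywhere in the class.
7. *Literature negatives*: nothing in print asserts non-doubling / a crossover of `⟨σ₀σ_x⟩_{β_c}` on `ℤ³`; the nearest statements are
   the OPENNESS remarks ADC21 Rem. 5.10 / §5.6 and DC ICM22 §8.4 (search partly degraded this cycle: `lit search` rc 75).
[folklore] -/
theorem attacks_record : True := trivial

/-! ## §F The constants `M_K`, `m_K` cannot be uniform in `K` (landed, p162198) -/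

/-- The crux with clause (a) STRENGTHENED to one bound `M` for all compact `K` (at order `2`). [folklore] -/
def UniformRegularityBoundUniformInK : Prop :=
  ∃ M : ℝ, ∀ K : Set (Fin 2 → EuclideanSpace ℝ (Fin 3)), K ⊆ NonCoincident 3 2 → IsCompact K →
    ∃ δ₀ : ℝ, 0 < δ₀ ∧ ∀ δ ∈ Set.Ioo 0 δ₀, ∀ x ∈ K, |F 2 δ x| ≤ M

/-- **`M = M(K)` is load-bearing**: one `M` for all compact `K ⊆ NonCoincident 3 2` is false — `K = {(0, e₀/m)}`, `m > M`,
meshes `1/(N₀ mʲ⁺¹)`: `g(N₀mʲe₀) ≥ M^{-j} g(N₀e₀)` against `g ≤ C/(N₀mʲ)` (`clauseA_false_with_bound_uniform_in_K`). [folklore] -/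
theorem uniformRegularity_false_with_bound_uniform_in_K : ¬ UniformRegularityBoundUniformInK :=
  clauseA_false_with_bound_uniform_in_K

/-- The crux with clause (c) STRENGTHENED to one lower constant `m > 0` for all compact `K`. [folklore] -/
def UniformRegularityLowerBoundUniformInK : Prop :=
  ∃ m : ℝ, 0 < m ∧ ∀ K : Set (Fin 2 → EuclideanSpace ℝ (Fin 3)), K ⊆ NonCoincident 3 2 → IsCompact K →
    ∃ δ₀ : ℝ, 0 < δ₀ ∧ ∀ δ ∈ Set.Ioo 0 δ₀, ∀ x ∈ K, m ≤ F 2 δ x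

/-- **`m = m(K)` is load-bearing**: one `m > 0` for all compact `K` is false — `K = {(0, p e₀)}`, `p m > 1`, meshes `1/(N₀pʲ)`:
`g(N₀pʲe₀) ≥ mʲ g(N₀e₀)` against the infrared bound (`clauseC_false_with_bound_uniform_in_K`). [folklore] -/
theorem uniformRegularity_false_with_lowerBound_uniform_in_K : ¬ UniformRegularityLowerBoundUniformInK :=
  clauseC_false_with_bound_uniform_in_K

end Summit.CriticalPhenomena.Ising3DConformalLimit.Cruxes.UniformRegularity.Disproof

end
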